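import Mathlib.MeasureTheory.Integral.Lebesgue.Markov
import Mathlib.MeasureTheory.Measure.Lebesgue.Basic
import HarnessLib

/-!
# Route ClusterCompleteness — crux `AdiabaticMultiKerrILED`, line `Sketch`: boundedness from the lossy integral inequality

Helper file for the crux `stmt-FinalStateConjecture-14310`
(`Summit.FinalStateConjecture.FinalStateConjecture.Theses.ClusterCompleteness.AdiabaticMultiKerrILED`),
closing the stub `stub_boundedOfIntegralIneq` of line `Sketch`: the real-variable lemma behind the
Dafermos–Rodnianski red-shift boundedness argument (arXiv:0811.0354, §3.3.4). A measurable
`G : ℝ → ℝ≥0∞`, finite on `[t₀, ∞)`, with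
`G(s₂) + ∫_{(s₁, s₂]} G ≤ B G(s₁) + K (1 + (s₂ − s₁))` for all `t₀ ≤ s₁ ≤ s₂` (`B ≥ 1`), satisfies
`G(t) ≤ 10 (B + 1) (G(t₀) + K)` for every `t ≥ t₀`.

Proof. If `K = ⊤` the bound is trivial. Otherwise put `M = G(t₀) + 4K < ⊤` and call `s ≥ t₀` *good* if
`G(s) ≤ M`.
* One step: for `t₀ ≤ s ≤ t ≤ s + 3B`, dropping the integral gives `G(t) ≤ B G(s) + K(1 + 3B) ≤ B G(s) + 4BK`.
* Window: if `s` is good, some `s' ∈ (s + B, s + 3B]` is good. Otherwise `G > M` on that window `W`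
  (Lebesgue measure `2B`), so `2B · M < ∫_W G` strictly (`setLIntegral_strict_mono`, `M < ⊤`), while the
  hypothesis on `[s, s + 3B] ⊇ W` gives `∫_W G ≤ B M + 4BK ≤ 2B · M` — contradiction.
* Cover: by induction on `n`, every `t ∈ [t₀, t₀ + nB]` has a good `s` with `s ≤ t ≤ s + 3B`
  (apply the induction hypothesis at `t − B` and, if the good point found lies more than `3B` below `t`,
  move it up by the window lemma).
* Conclusion (Archimedes for `n`): `G(t) ≤ B M + 4BK = B G(t₀) + 8BK ≤ 10 (B + 1)(G(t₀) + K)`. [folklore]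
-/

noncomputable section

-- the doubled `FinalStateConjecture.FinalStateConjecture` path component trips dupNamespace
set_option linter.dupNamespace false

open scoped ENNReal
open Set MeasureTheory

namespace Summit.FinalStateConjecture.FinalStateConjecture.Cruxes.AdiabaticMultiKerrILED.Sketch

/-- `K · ofReal (1 + d) ≤ 4BK` whenever `d ≤ 3B` and `B ≥ 1`. [folklore] -/
private theorem bddIneq_loss_le (B : NNReal) (K : ℝ≥0∞) (hB : (1 : ℝ) ≤ B) (d : ℝ)
    (hd : d ≤ 3 * (B : ℝ)) :
    K * ENNReal.ofReal (1 + d) ≤ 4 * (B : ℝ≥0∞) * K := by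
  have h : ENNReal.ofReal (1 + d) ≤ 4 * (B : ℝ≥0∞) := by
    calc ENNReal.ofReal (1 + d) ≤ ENNReal.ofReal (4 * (B : ℝ)) :=
          ENNReal.ofReal_le_ofReal (by linarith)
      _ = 4 * (B : ℝ≥0∞) := by
          rw [ENNReal.ofReal_mul (by norm_num), ENNReal.ofReal_ofNat, ENNReal.ofReal_coe_nnreal]
  calc K * ENNReal.ofReal (1 + d) ≤ K * (4 * (B : ℝ≥0∞)) := by gcongr
    _ = 4 * (B : ℝ≥0∞) * K := by ring

/-- One step of the lossy inequality: for `t₀ ≤ s ≤ t ≤ s + 3B`, dropping the integral,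
`G(t) ≤ B G(s) + 4BK`. [folklore] -/
private theorem bddIneq_step (G : ℝ → ℝ≥0∞) (t₀ : ℝ) (B : NNReal) (K : ℝ≥0∞) (hB : (1 : ℝ) ≤ B)
    (hineq : ∀ s₁ s₂ : ℝ, t₀ ≤ s₁ → s₁ ≤ s₂ →
      G s₂ + ∫⁻ s in Set.Ioc s₁ s₂, G s ≤
        (B : ℝ≥0∞) * G s₁ + K * ENNReal.ofReal (1 + (s₂ - s₁)))
    (s t : ℝ) (hs : t₀ ≤ s) (hst : s ≤ t) (hts : t ≤ s + 3 * (B : ℝ)) :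
    G t ≤ (B : ℝ≥0∞) * G s + 4 * (B : ℝ≥0∞) * K := by
  calc G t ≤ G t + ∫⁻ x in Set.Ioc s t, G x := le_self_add
    _ ≤ (B : ℝ≥0∞) * G s + K * ENNReal.ofReal (1 + (t - s)) := hineq s t hs hst
    _ ≤ (B : ℝ≥0∞) * G s + 4 * (B : ℝ≥0∞) * K := by
        gcongr (B : ℝ≥0∞) * G s + ?_
        exact bddIneq_loss_le B K hB _ (by linarith)

/-- Window lemma: if `G(s) ≤ M := G(t₀) + 4K` (`s ≥ t₀`, `K < ⊤`, `G(t₀) < ⊤`), then some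
`s' ∈ (s + B, s + 3B]` again has `G(s') ≤ M`; otherwise `2B · M < ∫_{(s+B, s+3B]} G ≤ B M + 4BK ≤ 2B · M`.
[folklore] -/
private theorem bddIneq_window (G : ℝ → ℝ≥0∞) (t₀ : ℝ) (B : NNReal) (K : ℝ≥0∞) (hG : Measurable G)
    (hB : (1 : ℝ) ≤ B) (hG₀ : G t₀ ≠ ⊤) (hK : K ≠ ⊤)
    (hineq : ∀ s₁ s₂ : ℝ, t₀ ≤ s₁ → s₁ ≤ s₂ →
      G s₂ + ∫⁻ s in Set.Ioc s₁ s₂, G s ≤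
        (B : ℝ≥0∞) * G s₁ + K * ENNReal.ofReal (1 + (s₂ - s₁)))
    (s : ℝ) (hs : t₀ ≤ s) (hsM : G s ≤ G t₀ + 4 * K) :
    ∃ s' : ℝ, s + (B : ℝ) < s' ∧ s' ≤ s + 3 * (B : ℝ) ∧ G s' ≤ G t₀ + 4 * K := by
  by_contra hcon
  push Not at hcon
  have hMfin : G t₀ + 4 * K ≠ ⊤ :=
    ENNReal.add_ne_top.mpr ⟨hG₀, ENNReal.mul_ne_top (by norm_num) hK⟩
  have hvol : volume (Set.Ioc (s + (B : ℝ)) (s + 3 * (B : ℝ))) = 2 * (B : ℝ≥0∞) := by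
    rw [Real.volume_Ioc, show s + 3 * (B : ℝ) - (s + (B : ℝ)) = 2 * (B : ℝ) by ring,
      ENNReal.ofReal_mul (by norm_num), ENNReal.ofReal_ofNat, ENNReal.ofReal_coe_nnreal]
  have hBpos : (0 : ℝ≥0∞) < (B : ℝ≥0∞) := by
    have : (0 : ℝ) < (B : ℝ) := by linarith
    exact_mod_cast this
  have hvol0 : volume (Set.Ioc (s + (B : ℝ)) (s + 3 * (B : ℝ))) ≠ 0 := by
    rw [hvol]; exact mul_ne_zero two_ne_zero hBpos.ne'
  -- strict lower bound for the window integral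
  have hlt : ∫⁻ _ in Set.Ioc (s + (B : ℝ)) (s + 3 * (B : ℝ)), G t₀ + 4 * K <
      ∫⁻ x in Set.Ioc (s + (B : ℝ)) (s + 3 * (B : ℝ)), G x := by
    refine setLIntegral_strict_mono measurableSet_Ioc hvol0 hG ?_
      (ae_of_all _ fun x hx => hcon x hx.1 hx.2)
    rw [setLIntegral_const, hvol]
    exact ENNReal.mul_ne_top hMfin (ENNReal.mul_ne_top (by norm_num) ENNReal.coe_ne_top)
  rw [setLIntegral_const, hvol] at hlt
  -- upper bound from the hypothesis on `[s, s + 3B]`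
  have h4 : 4 * (B : ℝ≥0∞) * K ≤ (B : ℝ≥0∞) * (G t₀ + 4 * K) := by
    calc 4 * (B : ℝ≥0∞) * K = (B : ℝ≥0∞) * (4 * K) := by ring
      _ ≤ (B : ℝ≥0∞) * G t₀ + (B : ℝ≥0∞) * (4 * K) := le_add_self
      _ = (B : ℝ≥0∞) * (G t₀ + 4 * K) := by ring
  have hle : ∫⁻ x in Set.Ioc (s + (B : ℝ)) (s + 3 * (B : ℝ)), G x ≤
      (G t₀ + 4 * K) * (2 * (B : ℝ≥0∞)) := by
    calc ∫⁻ x in Set.Ioc (s + (B : ℝ)) (s + 3 * (B : ℝ)), G x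
        ≤ ∫⁻ x in Set.Ioc s (s + 3 * (B : ℝ)), G x :=
          lintegral_mono_set (Set.Ioc_subset_Ioc_left (by linarith))
      _ ≤ G (s + 3 * (B : ℝ)) + ∫⁻ x in Set.Ioc s (s + 3 * (B : ℝ)), G x := le_add_self
      _ ≤ (B : ℝ≥0∞) * G s + K * ENNReal.ofReal (1 + (s + 3 * (B : ℝ) - s)) :=
          hineq s (s + 3 * (B : ℝ)) hs (by linarith)
      _ ≤ (B : ℝ≥0∞) * (G t₀ + 4 * K) + 4 * (B : ℝ≥0∞) * K :=
          add_le_add (mul_le_mul_right hsM _) (bddIneq_loss_le B K hB _ (by linarith))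
      _ ≤ (B : ℝ≥0∞) * (G t₀ + 4 * K) + (B : ℝ≥0∞) * (G t₀ + 4 * K) := add_le_add le_rfl h4
      _ = (G t₀ + 4 * K) * (2 * (B : ℝ≥0∞)) := by ring
  exact absurd hle (not_le.mpr hlt)

/-- Covering lemma: given the window property, every `t ∈ [t₀, t₀ + nB]` admits a good point `s`
(`t₀ ≤ s`, `G(s) ≤ G(t₀) + 4K`) with `s ≤ t ≤ s + 3B`; induction on `n`. [folklore] -/
private theorem bddIneq_cover (G : ℝ → ℝ≥0∞) (t₀ : ℝ) (B : NNReal) (K : ℝ≥0∞) (hB : (1 : ℝ) ≤ B)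
    (hwin : ∀ s : ℝ, t₀ ≤ s → G s ≤ G t₀ + 4 * K →
      ∃ s' : ℝ, s + (B : ℝ) < s' ∧ s' ≤ s + 3 * (B : ℝ) ∧ G s' ≤ G t₀ + 4 * K) :
    ∀ n : ℕ, ∀ t : ℝ, t₀ ≤ t → t ≤ t₀ + n * (B : ℝ) →
      ∃ s : ℝ, t₀ ≤ s ∧ G s ≤ G t₀ + 4 * K ∧ s ≤ t ∧ t ≤ s + 3 * (B : ℝ) := by
  have hM₀ : G t₀ ≤ G t₀ + 4 * K := le_self_add
  intro n
  induction n with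
  | zero =>
      intro t ht htn
      refine ⟨t₀, le_rfl, hM₀, ht, ?_⟩
      simp only [Nat.cast_zero, zero_mul, add_zero] at htn
      linarith
  | succ n ih =>
      intro t ht htn
      by_cases ht3 : t ≤ t₀ + 3 * (B : ℝ)
      · exact ⟨t₀, le_rfl, hM₀, ht, ht3⟩
      · push Not at ht3
        have htn' : t - (B : ℝ) ≤ t₀ + n * (B : ℝ) := by push_cast at htn; linarith
        obtain ⟨s, hs₀, hsM, hst, hts⟩ := ih (t - (B : ℝ)) (by linarith) htn'
        by_cases hts' : t ≤ s + 3 * (B : ℝ)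
        · exact ⟨s, hs₀, hsM, by linarith, hts'⟩
        · push Not at hts'
          obtain ⟨s', hs'₁, hs'₂, hs'M⟩ := hwin s hs₀ hsM
          exact ⟨s', by linarith, hs'M, by linarith, by linarith⟩

/-- **Boundedness from the lossy red-shift integral inequality** (the real-variable lemma behind
Dafermos–Rodnianski arXiv:0811.0354, §3.3.4): a measurable `G ≥ 0`, finite on `[t₀, ∞)`, with
`G(s₂) + ∫_{s₁}^{s₂} G ≤ B G(s₁) + K (1 + (s₂ − s₁))` for all `t₀ ≤ s₁ ≤ s₂` (`B ≥ 1`), is bounded: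
`G(t) ≤ 10 (B + 1) (G(t₀) + K)` for `t ≥ t₀`. Proof: `K = ⊤` is trivial; otherwise good points
(`G ≤ G(t₀) + 4K`) occur in every window `(s + B, s + 3B]` after a good `s` (strict monotonicity of the
set integral against the integral bound), hence within `3B` below every `t ≥ t₀`, and one more application
of the hypothesis gives `G(t) ≤ B G(t₀) + 8BK`. [folklore] -/
theorem stub_boundedOfIntegralIneq :
    ∀ (G : ℝ → ℝ≥0∞) (t₀ : ℝ) (B : NNReal) (K : ℝ≥0∞), Measurable G → 1 ≤ B →
      (∀ s, t₀ ≤ s → G s ≠ ⊤) →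
      (∀ s₁ s₂ : ℝ, t₀ ≤ s₁ → s₁ ≤ s₂ →
        G s₂ + ∫⁻ s in Set.Ioc s₁ s₂, G s ≤
          (B : ℝ≥0∞) * G s₁ + K * ENNReal.ofReal (1 + (s₂ - s₁))) →
      ∀ t, t₀ ≤ t → G t ≤ 10 * ((B : ℝ≥0∞) + 1) * (G t₀ + K) := by
  intro G t₀ B K hG hB hfin hineq t ht
  by_cases hK : K = ⊤
  · have h0 : 10 * ((B : ℝ≥0∞) + 1) ≠ 0 := mul_ne_zero (by norm_num) (by positivity)
    rw [hK, add_top, ENNReal.mul_top h0]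
    exact le_top
  have hB' : (1 : ℝ) ≤ (B : ℝ) := by exact_mod_cast hB
  have hBpos : (0 : ℝ) < (B : ℝ) := by linarith
  -- good points below `t`
  have hwin := bddIneq_window G t₀ B K hG hB' (hfin t₀ le_rfl) hK hineq
  obtain ⟨n, hn⟩ := exists_nat_ge ((t - t₀) / (B : ℝ))
  have htn : t ≤ t₀ + n * (B : ℝ) := by
    rw [div_le_iff₀ hBpos] at hn
    linarith
  obtain ⟨s, hs₀, hsM, hst, hts⟩ := bddIneq_cover G t₀ B K hB' hwin n t ht htn
  -- one more step of the hypothesis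
  calc G t ≤ (B : ℝ≥0∞) * G s + 4 * (B : ℝ≥0∞) * K := bddIneq_step G t₀ B K hB' hineq s t hs₀ hst hts
    _ ≤ (B : ℝ≥0∞) * (G t₀ + 4 * K) + 4 * (B : ℝ≥0∞) * K := by gcongr
    _ ≤ (B : ℝ≥0∞) * (G t₀ + 4 * K) + 4 * (B : ℝ≥0∞) * K +
        (9 * (B : ℝ≥0∞) * G t₀ + 2 * (B : ℝ≥0∞) * K + 10 * G t₀ + 10 * K) := le_self_add
    _ = 10 * ((B : ℝ≥0∞) + 1) * (G t₀ + K) := by ring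

end Summit.FinalStateConjecture.FinalStateConjecture.Cruxes.AdiabaticMultiKerrILED.Sketch
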